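import Mathlib
import Literature.MathematicalPhysics.QuantumFieldTheory.Balaban1983to89.T4AdInvariant
import Literature.MathematicalPhysics.QuantumFieldTheory.Balaban1983to89.T4FirstOrderSize

/-!
# T4NestedCovariance — the INDUCTION OVER THE FORMS of nested integral operations (cell `pub-balaban`,
T4-DAG v4 §5 row T4-O3.E-i′-Oα6°, obligation O-α6 of `t4/T4-EST-O3Ei1.md` §3 NET(α); EST shape, kernel bookkeeping)

HONEST FRAMING (cell `pub-balaban`, T4-DAG PAGE 1).  The cell's T4 target is the existence AND uniqueness of the
continuum limit of Bałaban's unit-scale averaged loop expectations on a finite torus — a constructive-QFT statement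
strictly beyond ultraviolet stability ([Balaban1989LargeFieldII] Thm 1 p. 355); it is NOT the Yang–Mills mass gap and
NOT the Clay problem.  This module is ABSTRACT and asserts NOTHING about Bałaban's renormalization-group objects: it
types, over an arbitrary configuration type `Ω` carrying a family of maps `ρ g : Ω → Ω` (for the consumer: the JOINT
rotation `V(b) ↦ gV(b)g⁻¹` of every bond variable at every scale by one constant `g ∈ G`), the elementary algebra by
which COVARIANCE of an integral operation `F ↦ 𝕋F` under the family — `𝕋(F ∘ ρ g) = (𝕋F) ∘ ρ g` — survives NESTING:
composition, finite sums over families, multiplication by invariant weights, substitution of commuting maps, and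
fibre integration against an invariant measure with an equivariant insertion.  The printed operations are "of many
forms" (quotations below); here a FORM is a finite syntax tree over those five node types (`Form`), its evaluation
`Form.eval` is the operation, and `Form.covariant_eval` is the induction over forms: a form each of whose nodes
carries its (one-level) symmetry hypothesis (`Form.Adapted`) evaluates to a covariant operation, which moreover
commutes with every continuous linear automorphism of the value space (`Form.commutesWith_eval`, unconditional).
Consequently an integrand equivariant under a representation `σ` stays equivariant through any adapted form
(`Form.equivariant_eval`), and at a configuration fixed by the family modulo the variables the form integrates out
(a FLAT exterior) its value is a `σ`-fixed vector — zero when `σ` has no fixed vectors (`T4AdInvariant.NoFixedVector`,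
`T4AdInvariant.pi_traceless_eq_zero_of_conj_invariant` for 𝔰𝔲(2)), which is the hypothesis shape
`T4FirstOrderSize.MeanVanishes` of row T4-O3.E-i′ (§6).  The ONE-LEVEL symmetry hypotheses at the nodes (Haar /
Lebesgue fibre measures conjugation invariant, cut-off functions built from Ad-invariant norms, background and
minimiser maps conjugation covariant, actions functions on orbits) are NOT proved here: they are obligations O-α3/O-α4
of the same record (row T4-O3.E-i′-Oα, module `T4FlatExteriorInvariance` of the pv04 lineage, in preparation) and enter
as the `Form.Adapted` hypotheses.  The failure mode the row names — an ingredient covariant only UP TO A DEFECT (e.g. a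
gauge-fixing substitution whose map commutes with the rotation except on boundary bonds) — is typed too
(`CovariantUpTo`, §5): defects propagate ADDITIVELY through an additive outer operation and the defect of a
substitution node is supported exactly where its map fails to commute.  Value = typed induction shape + kernel
bookkeeping of an implication ⇐ named one-level inputs; NOT summit progress.

Printed context (verbatim, page-cited, read on the rendered pages; the manuscripts under audit are quoted for the
FORMS of their operations only — no estimate and no disputed step of theirs is used anywhere below).
* THE FORMS ARE MANY, [Balaban1989LargeFieldI] p. 200: "The components of the regions are divided into two classes:
  the components satisfying the conditions (i), (ii), for which the corresponding integral operations are given by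
  the integrals in (1.76), and the remaining components, for which the integral operations have many forms, varying
  from the old 𝕋-operations to the integrals as in (1.76), but with some large field characteristic functions,
  through the intermediate operations described above. These operations are denoted by 𝕋″_k."; p. 201: "The
  operation 𝕋″_k above includes a summation over all possible forms of this operation in various components of
  Z_k\Z." … "The integrations in (1.99) are also factorized in those components."
  [cite: Balaban1989LargeFieldI, pp. 200–201]
* PRODUCTS OVER COMPONENTS AND ORDERED PRODUCTS OF ONE-STEP OPERATIONS, [Balaban1988Convergent] p. 258: "If Z_k is
  represented as a union of disjoint regions, e.g. as a union of connected components, Z_k = X₁∪….∪X_n, X_i∩X_j = ∅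
  for i≠j, then T_k(Z_k) = ∏_{i=1}^n T_k(X_i). (2.19) The operations corresponding to disjoint regions commute,
  i.e., T_k(X_i)T_k(X_j) = T_k(X_j)T_k(X_i). For a given large field region X the operation T_k(X) can be factorized
  into a product of one-step operations, and has the form T_k(X) = ∏_{j=k−1}^{0} T^{(j)}(Z_{j+1}∩X). (2.20) This is
  an ordered product, the order indicated in the product symbol."; and [Balaban1989LargeFieldI] (1.1) p. 177:
  "𝕋_k(Z_k) = 𝕋_k(Z_k∩Z^c)𝕋_k(Z) = 𝕋_k(Z_k∩Z^c) ∏_{i=1}^m 𝕋_k(X_i), (1.1) where Z = ∪_{i=1}^m X_i is the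
  decomposition into disjoint components.", (1.2) p. 178: "𝕋_k(Z) exp A_k = χ_k(Ω_k^{~4}) ∏_{j=k−1}^{h}
  𝕋^{(j)}(Z_{j+1}) χ_h(Ω\Ω^~_{h+1}) 𝕋_h(Z_h) exp A_k, (1.2) where h = k − N … These operations are given by the
  formula (2.21) [III] …".
  [cite: Balaban1988Convergent, (2.19)–(2.20) p. 258] [cite: Balaban1989LargeFieldI, (1.1)–(1.2) pp. 177–178]
* THE ONE-STEP FORM (fibre integrals with an averaging constraint, cut-off functions and a Gaussian weight),
  [Balaban1988Convergent] (2.21) p. 258: "T^{(j)}(Z_{j+1}∩X) = ∫dV_j|_{Ω^c_{j+1}∩X} δ(V̄_jV_{j+1}⁻¹)ζ(Ω^c_{j+1})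
  ·∫dA_j|_{Z_{j+1}∩Ω_{j+1}∩X} χ(Z_{j+1}∩Ω_{j+1}∩X) exp[−½⟨A_j,C*Δ^{(j)}CA_j⟩ + ½⟨A_j,C*Δ^{(j)}CC^{(j)}(Λ_{j+1})
  C*Δ^{(j)}CA_j⟩]. (2.21)" … "If the operation T^{(j)} is changed by an R-operation, then the general form (2.21) is
  preserved, but the characteristic functions are changed …".  [cite: Balaban1988Convergent, (2.21) p. 258]
* SUMS OVER FAMILIES, EUCLIDEAN AVERAGING, NORMALISED QUOTIENTS, GAUGE-FIXING δ'S, NESTED OLD OPERATIONS — the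
  display (1.100) of [Balaban1989LargeFieldI] p. 201: "(ℝ′ρ_k)(V_k) = Σ_{Z_k}(Σ_{{Ω^c_j,Z_j}} 𝕋″_k(Z_k))
  {Σ_{n≥0}Σ_{{X₁,…,X_n}} χ_k(Ω_k^{~4}) ∏_{i=1}^n [(1/N_i) Σ_{{Ω^c_{i,j},Z_{i,j}},G_i,T_i} χ_{k,Λ_i} · δ_{G_i}(V′_k)
  χ(Λ_i)exp[−(1/g_k²)A(ζ_i,U_{k,X_i}(V′_kV_{Λ_i}))] / ∫dV′⌈_{Λ_i}δ_{G_i}(V′)χ(Λ_i)exp[−(1/g_k²)A(ζ_i,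
  U_{k,X_i}(V′V_{Λ_i}))] ·∫dV_h⌈_{(Ω″~2_{i,h+1})^c}χ_{h,1/2}((Ω″~_{i,h+1})^c∩Ω_{i,h})𝕋_h(Z_{i,h})∫dV′⌈_{B_i}
  δ_{T_i}(V′)χ′_i] exp A″_k}, (1.100) where G_i is a graph in Λ_i fixing the axial gauge" … "Because of the gauge
  fixing terms the expressions in (1.100) are not Euclidean invariant, and we have introduced the averaging over
  families of graphs, such that the averaged expressions are invariant." … "We can also choose other ways of fixing
  a gauge, generalizing the Landau gauge, which are Euclidean invariant, but they are analytically much more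
  complicated."; the gauge fixing, p. 196: "We fix the gauge putting the bond variables equal to 1 for bonds
  belonging to the tree graph." … "Using the Faddeev–Popov procedure we introduce the gauge fixing δ-function
  δ_{T₀}(V′) in the integral (1.76)."; and the fluctuation / background substitution, (1.81) p. 195: "V″ = V′V₀ on
  Λ₀, V₀ = M_{𝔹″_k}(U₀)." … "The measure and the underintegral expressions in the second integral in (1.76) are
  gauge invariant; more precisely they are invariant with respect to the gauge transformations defined on 𝔹₀."
  [cite: Balaban1989LargeFieldI, (1.100) p. 201; p. 196; (1.81) p. 195]
* THE ROTATION IS A CONSTANT GAUGE TRANSFORMATION, [Balaban1987RG1] (1.10) p. 262: "A G^c-valued gauge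
  transformation u acts on pairs (U,J) in the following way (U,J)^u = (U^u, R(u)J) = (u₋Uu₊⁻¹, R(u₋)J), (1.10)
  where for a bond b = ⟨b₋,b₊⟩ we define u_±(b) = u(b_±)." — for the CONSTANT transformation u ≡ g this reads
  U(b) ↦ gU(b)g⁻¹, J ↦ R(g)J [folklore].  [cite: Balaban1987RG1, (1.10) p. 262]

Dictionary printed form ↦ node (the cell's READING of the displays, t4/T4-EST-O3Ei-alpha6.md §2; each arrow's
one-level hypothesis is named, not proved): products (2.19)/(1.1) over components and ordered products (2.20)/(1.2)
↦ `Form.comp` / `Form.pi`; Σ over families {Ω^c_j,Z_j}, (X₁,…,X_n) and the averages (1/N_i)Σ_{G_i,T_i} ↦ `Form.sum`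
(+ constant weights, `Form.mul`); χ's, ζ's, exp A″_k, exp[−(1/g_k²)A(…)], the Gaussian weight of (2.21) ↦ `Form.mul`
with `Invariant` (O-α3: Ad-invariant norms; actions are functions on orbits); V″ = V′V₀, U_{k,X}(V′V_Λ), rescalings
↦ `Form.subst` with a commuting map (O-α4: covariant background / minimiser / averaging maps); "putting the bond
variables equal to 1 for bonds belonging to the tree graph" ↦ `Form.subst` by the map fixing those coordinates at the
identity, which commutes with conjugation since g1g⁻¹ = 1 [folklore]; ∫dV⌈, ∫dV′⌈, ∫dA ↦ `Form.fibre` (Haar / Lebesgue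
on the integrated variables, conjugation / Ad invariant, inserted equivariantly); the quotient of (1.100) ↦ `Form.mul`
by `Form.normaliser` (§4); an OLD operation 𝕋_h(Z_{i,h}) nested inside ↦ a sub-tree — the induction.  NOT rendered:
the Euclidean (lattice-rotation) covariance, which the printed text says the gauge-fixing terms break and the
averaging over graphs restores (p. 201 below) — the family `ρ` here is the GLOBAL COLOUR rotation only, under which
the tree-gauge condition V(b) = 1 is stable; a gauge-fixing or cut-off ingredient that is colour-covariant only up to a
defect is exactly the §5 failure mode and is then NOT an `Adapted` node.

Interfaces (cell coordination, T4-DAG v4/v5 §5).  SUPPLIER of the node hypotheses (`Form.Adapted`: `Invariant`,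
commuting substitutions, `InvariantFibre` + `EquivariantInsertion`): row T4-O3.E-i′-Oα (pv04 lineage, module
`T4FlatExteriorInvariance`, ONE level: law invariance under the constant conjugation `conjFun g`, invariant
multipliers `ConjInvariant`, covariant averaging maps) — its outputs are of the shapes the nodes ask for (a law
invariance under a measurable action with measurable inverses ↦ `InvariantFibre` by `invariantFibre_of_inverse`;
`ConjInvariant` ↦ `Invariant`; covariant maps ↦ commuting substitutions); the instantiation node by node is done in
NEITHER module and remains the record's obligation (t4/T4-EST-O3Ei-alpha6.md §3).
`InvariantFibre.flatExteriorConjInvariant` shows the fibre hypothesis is the `T4AdInvariant.FlatExteriorConjInvariant`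
shape with measurability strengthened to a measurable embedding, which makes every statement here junk-safe: no
integrability or measurability hypothesis on integrands anywhere.  CONSUMERS: `T4FirstOrderSize.MeanVanishes`
(row T4-O3.E-i′, via `meanVanishes_of_covariant` / `Form.meanVanishes`), and the 𝔰𝔲(2) coordinate form
`Form.eval_eq_zero_of_conjEquivariant` (via `T4AdInvariant`).

What is proved (all [folklore]/[folklore]: change of variables under a measure-preserving measurable embedding
(`MeasurableEmbedding.integral_map`), continuous linear equivalences commute with the Bochner integral without
integrability (`ContinuousLinearEquiv.integral_comp_comm`), `map_sum`/`map_smul`, structural induction).  No `sorry`;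
standard axioms only.
-/

noncomputable section

open MeasureTheory
open scoped BigOperators

namespace Literature.MathematicalPhysics.QuantumFieldTheory.Balaban1983to89.T4NestedCovariance

universe u v w

/-! ## §1  Invariant weights, equivariant integrands, covariant operations — and the transport lemma -/

section Algebra

variable {G : Type*} {Ω : Type*} {E : Type*} {𝕜 : Type*}

/-- A scalar weight `χ` on configurations is INVARIANT under the family `ρ` (cut-off functions of Ad-invariant norms,
actions that are functions on orbits, normalisers). [folklore] -/
def Invariant (ρ : G → Ω → Ω) (χ : Ω → 𝕜) : Prop := ∀ g ω, χ (ρ g ω) = χ ω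

/-- An `E`-valued integrand `F` is EQUIVARIANT: `F (ρ g ω) = σ g (F ω)` for a family of maps `σ g : E → E` (for the
consumer: `σ g = Ad(g)`, cf. `T4AdInvariant.ConjEquivariant`, which is the case `σ g = conjOp g`). [folklore] -/
def Equivariant (ρ : G → Ω → Ω) (σ : G → E → E) (F : Ω → E) : Prop := ∀ g ω, F (ρ g ω) = σ g (F ω)

/-- Invariance is equivariance for the trivial family. [folklore] -/
theorem invariant_iff_equivariant (ρ : G → Ω → Ω) (χ : Ω → 𝕜) :
    Invariant ρ χ ↔ Equivariant ρ (fun _ => id) χ := Iff.rfl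

/-- An INTEGRAL OPERATION: a map `F ↦ 𝕋F` on `E`-valued functions of the (total) configuration; the value `𝕋F ω`
depends only on the variables `𝕋` does not integrate, but it is convenient to keep one configuration type.
[folklore] -/
abbrev Op (Ω : Type*) (E : Type*) := (Ω → E) → (Ω → E)

/-- COVARIANCE of an operation under the family `ρ`: `𝕋 (F ∘ ρ g) = (𝕋 F) ∘ ρ g`. [folklore] -/
def Covariant (ρ : G → Ω → Ω) (𝕋 : Op Ω E) : Prop :=
  ∀ g (F : Ω → E), 𝕋 (fun ω => F (ρ g ω)) = fun ω => 𝕋 F (ρ g ω)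

/-- The operation COMMUTES with post-composition by a map `A : E → E` (for the consumer: every `Ad(g)`; it holds
for all continuous linear automorphisms at once for the printed forms, `Form.commutesWith_eval`). [folklore] -/
def CommutesWith (A : E → E) (𝕋 : Op Ω E) : Prop :=
  ∀ F : Ω → E, 𝕋 (fun ω => A (F ω)) = fun ω => A (𝕋 F ω)

/-- TRANSPORT LEMMA: a covariant operation commuting with the `σ g` maps equivariant integrands to equivariant
outputs. [folklore] -/
theorem Equivariant.op {ρ : G → Ω → Ω} {σ : G → E → E} {𝕋 : Op Ω E} (hcov : Covariant ρ 𝕋)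
    (hcomm : ∀ g, CommutesWith (σ g) 𝕋) {F : Ω → E} (hF : Equivariant ρ σ F) :
    Equivariant ρ σ (𝕋 F) := by
  intro g ω
  have h1 : 𝕋 (fun ω => σ g (F ω)) ω = 𝕋 F (ρ g ω) := by
    have h := hcov g F
    rw [show (fun ω => F (ρ g ω)) = fun ω => σ g (F ω) from funext (hF g)] at h
    exact congrFun h ω
  have h3 : 𝕋 (fun ω => σ g (F ω)) ω = σ g (𝕋 F ω) := congrFun (hcomm g F) ω
  rw [← h1, h3]

/-- Scalar case: a covariant operation maps invariant weights to invariant weights (normalisers). [folklore] -/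
theorem Invariant.op {ρ : G → Ω → Ω} {𝕋 : Op Ω 𝕜} (hcov : Covariant ρ 𝕋) {χ : Ω → 𝕜} (hχ : Invariant ρ χ) :
    Invariant ρ (𝕋 χ) := by
  intro g ω
  have h1 := congrFun (hcov g χ) ω
  have h2 : (fun ω => χ (ρ g ω)) = χ := funext (hχ g)
  rw [h2] at h1
  exact h1.symm

/-- Pointwise inverses of invariant weights are invariant. [folklore] -/
theorem Invariant.inv [Inv 𝕜] {ρ : G → Ω → Ω} {χ : Ω → 𝕜} (hχ : Invariant ρ χ) :
    Invariant ρ (fun ω => (χ ω)⁻¹) := fun g ω => by simp only [hχ g ω]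

/-- Products of invariant weights are invariant. [folklore] -/
theorem Invariant.mul [Mul 𝕜] {ρ : G → Ω → Ω} {χ ψ : Ω → 𝕜} (hχ : Invariant ρ χ) (hψ : Invariant ρ ψ) :
    Invariant ρ (fun ω => χ ω * ψ ω) := fun g ω => by simp only [hχ g ω, hψ g ω]

/-- Constant weights are invariant. [folklore] -/
theorem invariant_const (ρ : G → Ω → Ω) (c : 𝕜) : Invariant ρ (fun _ => c) := fun _ _ => rfl

/-- An invariant scalar weight times an equivariant integrand is equivariant when the `σ g` commute with that
scalar. [folklore] -/
theorem Equivariant.smul [SMul 𝕜 E] {ρ : G → Ω → Ω} {σ : G → E → E} {χ : Ω → 𝕜} {F : Ω → E}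
    (hχ : Invariant ρ χ) (hF : Equivariant ρ σ F) (hσ : ∀ g (c : 𝕜) (v : E), σ g (c • v) = c • σ g v) :
    Equivariant ρ σ (fun ω => χ ω • F ω) := fun g ω => by simp only [hχ g ω, hF g ω, hσ]

/-! ### Closure of covariance / commutation under the node operations -/

/-- The identity operation is covariant. [folklore] -/
theorem covariant_id (ρ : G → Ω → Ω) : Covariant ρ (id : Op Ω E) := fun _ _ => rfl

/-- COMPOSITION (nesting; products over components; ordered products of one-step operations). [folklore] -/
theorem Covariant.comp {ρ : G → Ω → Ω} {𝕋₁ 𝕋₂ : Op Ω E} (h₁ : Covariant ρ 𝕋₁) (h₂ : Covariant ρ 𝕋₂) :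
    Covariant ρ (𝕋₁ ∘ 𝕋₂) := by
  intro g F
  show 𝕋₁ (𝕋₂ _) = _
  rw [h₂ g F, h₁ g (𝕋₂ F)]
  rfl

/-- [folklore] -/
theorem commutesWith_id (A : E → E) : CommutesWith A (id : Op Ω E) := fun _ => rfl

/-- [folklore] -/
theorem CommutesWith.comp {A : E → E} {𝕋₁ 𝕋₂ : Op Ω E} (h₁ : CommutesWith A 𝕋₁) (h₂ : CommutesWith A 𝕋₂) :
    CommutesWith A (𝕋₁ ∘ 𝕋₂) := by
  intro F
  show 𝕋₁ (𝕋₂ _) = _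
  rw [h₂ F, h₁ (𝕋₂ F)]
  rfl

/-- MULTIPLICATION by a scalar weight (cut-off functions, exponentials of actions, normalisers, the constants
1/N_i). [folklore] -/
def mulOp [SMul 𝕜 E] (χ : Ω → 𝕜) : Op Ω E := fun F ω => χ ω • F ω

/-- SUBSTITUTION of a map of configurations into the integrand (background / fluctuation splitting V″ = V′V₀,
minimisers, rescalings, fixing tree-bond variables at 1). [folklore] -/
def substOp (τ : Ω → Ω) : Op Ω E := fun F ω => F (τ ω)

/-- FINITE SUM of operations (sums over families of regions / graphs; Euclidean averaging). [folklore] -/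
def sumOp [AddCommMonoid E] {ι : Type*} (s : Finset ι) (𝕋 : ι → Op Ω E) : Op Ω E :=
  fun F ω => ∑ i ∈ s, 𝕋 i F ω

/-- FIBRE INTEGRATION: integrate the variables `s ∈ S` (inserted into the configuration by `ins s`) against a
measure `ν` (Haar on the integrated bond variables, Lebesgue on Lie-algebra-valued fluctuation fields). [folklore] -/
def fibreOp [NormedAddCommGroup E] [NormedSpace ℝ E] {S : Type*} [MeasurableSpace S] (ν : Measure S)
    (ins : S → Ω → Ω) : Op Ω E := fun F ω => ∫ s, F (ins s ω) ∂ν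

/-- An invariant weight gives a covariant multiplication. [folklore] -/
theorem covariant_mulOp [SMul 𝕜 E] {ρ : G → Ω → Ω} {χ : Ω → 𝕜} (hχ : Invariant ρ χ) :
    Covariant ρ (mulOp χ : Op Ω E) := fun g F => by
  funext ω
  simp only [mulOp, hχ g ω]

/-- Multiplication by scalars commutes with every map commuting with scalars. [folklore] -/
theorem commutesWith_mulOp [SMul 𝕜 E] {A : E → E} (hA : ∀ (c : 𝕜) (v : E), A (c • v) = c • A v) (χ : Ω → 𝕜) :
    CommutesWith A (mulOp χ : Op Ω E) := fun F => by
  funext ω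
  simp only [mulOp, hA]

/-- A substitution by a map COMMUTING with the family is covariant. [folklore] -/
theorem covariant_substOp {ρ : G → Ω → Ω} {τ : Ω → Ω} (hτ : ∀ g ω, τ (ρ g ω) = ρ g (τ ω)) :
    Covariant ρ (substOp τ : Op Ω E) := fun g F => by
  funext ω
  simp only [substOp, hτ g ω]

/-- Substitutions commute with every post-composition. [folklore] -/
theorem commutesWith_substOp (A : E → E) (τ : Ω → Ω) : CommutesWith A (substOp τ : Op Ω E) := fun _ => rfl

/-- A finite sum of covariant operations is covariant. [folklore] -/
theorem covariant_sumOp [AddCommMonoid E] {ρ : G → Ω → Ω} {ι : Type*} {s : Finset ι} {𝕋 : ι → Op Ω E}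
    (h : ∀ i ∈ s, Covariant ρ (𝕋 i)) : Covariant ρ (sumOp s 𝕋) := fun g F => by
  funext ω
  simp only [sumOp]
  exact Finset.sum_congr rfl fun i hi => by rw [h i hi g F]

/-- A finite sum of operations commuting with an additive `A` commutes with `A`. [folklore] -/
theorem commutesWith_sumOp [AddCommMonoid E] {F' : Type*} [FunLike F' E E] [AddMonoidHomClass F' E E] (A : F')
    {ι : Type*} {s : Finset ι} {𝕋 : ι → Op Ω E} (h : ∀ i ∈ s, CommutesWith A (𝕋 i)) :
    CommutesWith A (sumOp s 𝕋) := fun F => by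
  funext ω
  simp only [sumOp]
  rw [map_sum]
  exact Finset.sum_congr rfl fun i hi => by rw [h i hi F]

/-- HYPOTHESIS SHAPE at a fibre node: the fibre measure `ν` is invariant under maps `ρS g` which are measurable
embeddings (product Haar under simultaneous conjugation; Lebesgue under Ad).  Strengthens the measurability clause
of `T4AdInvariant.FlatExteriorConjInvariant` (a.e.-measurable ↦ measurable embedding) so that no measurability is
ever asked of integrands. [folklore] -/
def InvariantFibre {S : Type*} [MeasurableSpace S] (ρS : G → S → S) (ν : Measure S) : Prop :=
  ∀ g, MeasurableEmbedding (ρS g) ∧ Measure.map (ρS g) ν = ν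

/-- HYPOTHESIS SHAPE at a fibre node: inserting fibre variables is EQUIVARIANT — rotating the whole configuration
after insertion = inserting the rotated fibre variables into the rotated configuration. [folklore] -/
def EquivariantInsertion {S : Type*} (ρ : G → Ω → Ω) (ρS : G → S → S) (ins : S → Ω → Ω) : Prop :=
  ∀ g s ω, ρ g (ins s ω) = ins (ρS g s) (ρ g ω)

/-- A measurable action with measurable two-sided inverses (`ρS (ι g)` inverse to `ρS g`, e.g. `ι = (·)⁻¹` for a
group action by simultaneous conjugation) preserving `ν` is an `InvariantFibre`: the measurable-embedding clause is
automatic (`MeasurableEquiv.measurableEmbedding`). [folklore] -/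
theorem invariantFibre_of_inverse {S : Type*} [MeasurableSpace S] {ρS : G → S → S} {ν : Measure S} (ι : G → G)
    (hmeas : ∀ g, Measurable (ρS g)) (hinv₁ : ∀ g s, ρS (ι g) (ρS g s) = s)
    (hinv₂ : ∀ g s, ρS g (ρS (ι g) s) = s) (hν : ∀ g, Measure.map (ρS g) ν = ν) : InvariantFibre ρS ν :=
  fun g => ⟨(⟨⟨ρS g, ρS (ι g), hinv₁ g, hinv₂ g⟩, hmeas g, hmeas (ι g)⟩ : S ≃ᵐ S).measurableEmbedding, hν g⟩

/-- `InvariantFibre` is (a strengthening of) the `T4AdInvariant.FlatExteriorConjInvariant` shape. [folklore] -/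
theorem InvariantFibre.flatExteriorConjInvariant {S : Type*} [MeasurableSpace S] {ν : Measure S}
    {ρS : Matrix.specialUnitaryGroup (Fin 2) ℂ → S → S} (h : InvariantFibre ρS ν) :
    T4AdInvariant.FlatExteriorConjInvariant ν ρS := fun g => ⟨(h g).1.measurable.aemeasurable, (h g).2⟩

/-- THE BASE FORM: fibre integration against an invariant measure with an equivariant insertion is covariant —
change of variables, with NO hypothesis on the integrand. [folklore] -/
theorem covariant_fibreOp [NormedAddCommGroup E] [NormedSpace ℝ E] {ρ : G → Ω → Ω} {S : Type*}
    [MeasurableSpace S] {ν : Measure S} {ρS : G → S → S} {ins : S → Ω → Ω} (hν : InvariantFibre ρS ν)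
    (hins : EquivariantInsertion ρ ρS ins) : Covariant ρ (fibreOp ν ins : Op Ω E) := fun g F => by
  funext ω
  simp only [fibreOp, hins g]
  have h := (hν g).1.integral_map (μ := ν) (fun s => F (ins s (ρ g ω)))
  rw [(hν g).2] at h
  exact h.symm

/-- Fibre integration commutes with every continuous linear automorphism of the value space — NO integrability
hypothesis (`ContinuousLinearEquiv.integral_comp_comm`). [folklore] -/
theorem commutesWith_fibreOp [NormedAddCommGroup E] [NormedSpace ℝ E] [RCLike 𝕜] [NormedSpace 𝕜 E]
    (A : E ≃L[𝕜] E) {S : Type*} [MeasurableSpace S] (ν : Measure S) (ins : S → Ω → Ω) :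
    CommutesWith A (fibreOp ν ins : Op Ω E) := fun F => by
  funext ω
  exact A.integral_comp_comm (fun s => F (ins s ω))

end Algebra

/-! ## §2  The printed FORMS as a syntax, and their evaluation -/

/-- A FORM of integral operation: a finite tree over the five node types read off the printed displays (module
docstring; the phrase «many forms» is [Balaban1989LargeFieldI] p. 200).  Leaves: the identity, multiplication by a
scalar weight, substitution of a map of configurations, fibre integration (variables `S`, measure `ν`, insertion
`ins`); combinators: composition (nesting / products) and finite sums (families / averages).  An abstraction of this
module, not an object of the papers. [folklore] -/
inductive Form (Ω : Type u) (𝕜 : Type v) : Type (max (u + 1) v)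
  | one : Form Ω 𝕜
  | mul (χ : Ω → 𝕜) : Form Ω 𝕜
  | subst (τ : Ω → Ω) : Form Ω 𝕜
  | fibre (S : Type u) (mS : MeasurableSpace S) (ν : Measure S) (ins : S → Ω → Ω) : Form Ω 𝕜
  | comp (f₁ f₂ : Form Ω 𝕜) : Form Ω 𝕜
  | sum (ι : Type u) (s : Finset ι) (f : ι → Form Ω 𝕜) : Form Ω 𝕜

namespace Form

variable {Ω : Type u} {𝕜 : Type v}

/-- The ordered product `f₁ ∘ f₂ ∘ ⋯ ∘ f_n` of a list of forms (the combinator for the printed ordered products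
(2.20) and products over components (2.19)/(1.1) quoted in the module docstring). [folklore] -/
def pi : List (Form Ω 𝕜) → Form Ω 𝕜
  | [] => one
  | f :: fs => comp f (pi fs)

section Eval

variable {E : Type w} [NormedAddCommGroup E] [NormedSpace ℝ E] [SMul 𝕜 E]

/-- EVALUATION of a form as an operation on `E`-valued integrands (inner node `f₂` of `comp f₁ f₂` acts first).
[folklore] -/
def eval : Form Ω 𝕜 → Op Ω E
  | one => fun F => F
  | mul χ => fun F ω => χ ω • F ω
  | subst τ => fun F ω => F (τ ω)
  | fibre _ _ ν ins => fun F ω => ∫ s, F (ins s ω) ∂ν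
  | comp f₁ f₂ => fun F => eval f₁ (eval f₂ F)
  | sum _ s f => fun F ω => ∑ i ∈ s, eval (f i) F ω

/-- `eval` at the identity leaf. [folklore] -/
@[simp] theorem eval_one (F : Ω → E) : (one : Form Ω 𝕜).eval F = F := rfl

/-- `eval` at a multiplication leaf is `mulOp`. [folklore] -/
@[simp] theorem eval_mul (χ : Ω → 𝕜) (F : Ω → E) : (mul χ).eval F = fun ω => χ ω • F ω := rfl

/-- `eval` at a substitution leaf is `substOp`. [folklore] -/
@[simp] theorem eval_subst (τ : Ω → Ω) (F : Ω → E) : (subst τ : Form Ω 𝕜).eval F = fun ω => F (τ ω) := rfl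

/-- `eval` at a fibre leaf is `fibreOp`. [folklore] -/
@[simp] theorem eval_fibre {S : Type u} (mS : MeasurableSpace S) (ν : Measure S) (ins : S → Ω → Ω) (F : Ω → E) :
    (fibre S mS ν ins : Form Ω 𝕜).eval F = fun ω => ∫ s, F (ins s ω) ∂ν := rfl

/-- `eval` at a composition node: the inner form acts first. [folklore] -/
@[simp] theorem eval_comp (f₁ f₂ : Form Ω 𝕜) (F : Ω → E) : (comp f₁ f₂).eval F = f₁.eval (f₂.eval F) := rfl

/-- `eval` at a sum node is `sumOp` of the evaluations. [folklore] -/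
@[simp] theorem eval_sum {ι : Type u} (s : Finset ι) (f : ι → Form Ω 𝕜) (F : Ω → E) :
    (sum ι s f).eval F = fun ω => ∑ i ∈ s, (f i).eval F ω := rfl

/-- Evaluation of an ordered product is the iterated composition. [folklore] -/
theorem eval_pi_cons (f : Form Ω 𝕜) (fs : List (Form Ω 𝕜)) (F : Ω → E) :
    (pi (f :: fs)).eval F = f.eval ((pi fs).eval F) := rfl

end Eval

/-! ## §3  Node hypotheses and THE INDUCTION OVER FORMS -/

section Induction

variable {G : Type*}

/-- ADAPTEDNESS of a form to the family `ρ`: each node carries its ONE-LEVEL symmetry hypothesis — weights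
invariant, substitutions commuting, fibre measures invariant under some compatible family `ρS` with an equivariant
insertion.  These are the obligations O-α3/O-α4 of `t4/T4-EST-O3Ei1.md`, NOT proved in this module. [folklore] -/
def Adapted (ρ : G → Ω → Ω) : Form Ω 𝕜 → Prop
  | one => True
  | mul χ => Invariant ρ χ
  | subst τ => ∀ g ω, τ (ρ g ω) = ρ g (τ ω)
  | fibre S mS ν ins => ∃ ρS : G → S → S, @InvariantFibre G S mS ρS ν ∧ EquivariantInsertion ρ ρS ins
  | comp f₁ f₂ => Adapted ρ f₁ ∧ Adapted ρ f₂
  | sum _ s f => ∀ i ∈ s, Adapted ρ (f i)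

/-- An ordered product of adapted forms is adapted. [folklore] -/
theorem adapted_pi {ρ : G → Ω → Ω} : ∀ {fs : List (Form Ω 𝕜)}, (∀ f ∈ fs, Adapted ρ f) → Adapted ρ (pi fs)
  | [], _ => trivial
  | f :: fs, h => ⟨h f (by simp), adapted_pi fun f' hf' => h f' (by simp [hf'])⟩

variable {E : Type w} [NormedAddCommGroup E] [NormedSpace ℝ E]

/-- THE INDUCTION OVER FORMS (obligation O-α6, kernel half): an adapted form evaluates to a COVARIANT operation,
for integrands with values in any real normed space with compatible scalars. [folklore] -/
theorem covariant_eval [SMul 𝕜 E] {ρ : G → Ω → Ω} :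
    ∀ (f : Form Ω 𝕜), f.Adapted ρ → Covariant ρ (f.eval : Op Ω E)
  | one, _ => fun _ _ => rfl
  | mul _, h => covariant_mulOp (E := E) h
  | subst _, h => covariant_substOp (E := E) h
  | fibre S mS ν ins, ⟨ρS, hν, hins⟩ => @covariant_fibreOp G Ω E _ _ ρ S mS ν ρS ins hν hins
  | comp f₁ f₂, ⟨h₁, h₂⟩ => (covariant_eval f₁ h₁).comp (covariant_eval f₂ h₂)
  | sum _ _ f, h => covariant_sumOp fun i hi => covariant_eval (f i) (h i hi)

/-- Invariant weights stay invariant through an adapted form (scalar evaluation; normalisers). [folklore] -/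
theorem invariant_eval [RCLike 𝕜] {ρ : G → Ω → Ω} (f : Form Ω 𝕜) (hf : f.Adapted ρ) {χ : Ω → 𝕜}
    (hχ : Invariant ρ χ) : Invariant ρ (f.eval (E := 𝕜) χ) :=
  Invariant.op (covariant_eval (E := 𝕜) f hf) hχ

/-- UNCONDITIONALLY, every form commutes with every continuous linear automorphism of the value space (linearity of
sums, scalar weights and substitutions; `ContinuousLinearEquiv.integral_comp_comm` at fibre nodes — no
integrability). [folklore] -/
theorem commutesWith_eval [RCLike 𝕜] [NormedSpace 𝕜 E] (A : E ≃L[𝕜] E) :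
    ∀ f : Form Ω 𝕜, CommutesWith A (f.eval : Op Ω E)
  | one => fun _ => rfl
  | mul χ => commutesWith_mulOp (fun c v => by simp) χ
  | subst τ => commutesWith_substOp A τ
  | fibre S mS ν ins => @commutesWith_fibreOp Ω E 𝕜 _ _ _ _ A S mS ν ins
  | comp f₁ f₂ => (commutesWith_eval A f₁).comp (commutesWith_eval A f₂)
  | sum _ s f => commutesWith_sumOp A fun i _ => commutesWith_eval A (f i)

/-- EQUIVARIANT IN, EQUIVARIANT OUT: through an adapted form, an integrand equivariant under a representation by
continuous linear automorphisms stays equivariant. [folklore] -/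
theorem equivariant_eval [RCLike 𝕜] [NormedSpace 𝕜 E] {ρ : G → Ω → Ω} (σ : G → E ≃L[𝕜] E) (f : Form Ω 𝕜)
    (hf : f.Adapted ρ) {F : Ω → E} (hF : Equivariant ρ (fun g => σ g) F) :
    Equivariant ρ (fun g => σ g) (f.eval F) :=
  hF.op (covariant_eval f hf) fun g => commutesWith_eval (σ g) f

end Induction

/-! ## §4  Derived forms: normalised (conditional) operations -/

section Derived

variable {G : Type*} [RCLike 𝕜]

/-- The NORMALISER of a weight `w` through a form `f₀`: `ω ↦ ((f₀.eval w) ω)⁻¹` (the combinator for the printed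
denominators, e.g. of (1.100) quoted in the module docstring). [folklore] -/
def normaliser (f₀ : Form Ω 𝕜) (w : Ω → 𝕜) : Ω → 𝕜 := fun ω => (f₀.eval (E := 𝕜) w ω)⁻¹

/-- The normaliser of an invariant weight through an adapted form is an invariant weight. [folklore] -/
theorem invariant_normaliser {ρ : G → Ω → Ω} {f₀ : Form Ω 𝕜} (hf₀ : f₀.Adapted ρ) {w : Ω → 𝕜}
    (hw : Invariant ρ w) : Invariant ρ (normaliser f₀ w) :=
  (invariant_eval f₀ hf₀ hw).inv

/-- The CONDITIONAL (normalised) form `F ↦ (f₀ w)⁻¹ · f (w · F)`: weight `w` inserted, the operation `f`, division by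
the normaliser computed through `f₀` (for a conditional expectation `f₀ = f`). [folklore] -/
def cond (f₀ : Form Ω 𝕜) (w : Ω → 𝕜) (f : Form Ω 𝕜) : Form Ω 𝕜 := comp (mul (normaliser f₀ w)) (comp f (mul w))

/-- A conditional form built from adapted forms and an invariant weight is adapted. [folklore] -/
theorem adapted_cond {ρ : G → Ω → Ω} {f₀ f : Form Ω 𝕜} (hf₀ : f₀.Adapted ρ) (hf : f.Adapted ρ) {w : Ω → 𝕜}
    (hw : Invariant ρ w) : (cond f₀ w f).Adapted ρ :=
  ⟨invariant_normaliser hf₀ hw, hf, hw⟩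

/-- Unfolding the conditional form. [folklore] -/
theorem eval_cond {E : Type w} [NormedAddCommGroup E] [NormedSpace ℝ E] [SMul 𝕜 E] (f₀ f : Form Ω 𝕜) (w : Ω → 𝕜)
    (F : Ω → E) (ω : Ω) :
    (cond f₀ w f).eval F ω = (f₀.eval (E := 𝕜) w ω)⁻¹ • f.eval (fun ω' => w ω' • F ω') ω := rfl

end Derived

end Form

/-! ## §5  The failure mode, typed: covariance UP TO A DEFECT and its additive propagation -/

section Defect

variable {G : Type*} {Ω : Type u} {𝕜 : Type v} {E : Type w}

/-- `𝕋` is covariant UP TO THE DEFECT `D`: `𝕋 (F ∘ ρ g) = (𝕋 F) ∘ ρ g + D g F` (an ingredient covariant only up to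
a boundary term). [folklore] -/
def CovariantUpTo [Add E] (ρ : G → Ω → Ω) (𝕋 : Op Ω E) (D : G → (Ω → E) → (Ω → E)) : Prop :=
  ∀ g (F : Ω → E), 𝕋 (fun ω => F (ρ g ω)) = (fun ω => 𝕋 F (ρ g ω)) + D g F

/-- Zero defect is covariance. [folklore] -/
theorem covariantUpTo_zero_iff [AddZeroClass E] {ρ : G → Ω → Ω} {𝕋 : Op Ω E} :
    CovariantUpTo ρ 𝕋 (fun _ _ => 0) ↔ Covariant ρ 𝕋 := by
  simp only [CovariantUpTo, Covariant, add_zero]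

/-- The defect of a SUBSTITUTION node is the commutator term: it is supported exactly on the configurations where
the substituted map fails to commute with the family (e.g. boundary bonds of a gauge-fixing map). [folklore] -/
theorem covariantUpTo_substOp [AddCommGroup E] (ρ : G → Ω → Ω) (τ : Ω → Ω) :
    CovariantUpTo ρ (substOp τ : Op Ω E) fun g F ω => F (ρ g (τ ω)) - F (τ (ρ g ω)) := fun g F => by
  funext ω
  simp only [substOp, Pi.add_apply]
  abel

/-- A substitution node's defect VANISHES where the map commutes. [folklore] -/
theorem substOp_defect_eq_zero [AddGroup E] {ρ : G → Ω → Ω} {τ : Ω → Ω} {g : G} {ω : Ω}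
    (h : τ (ρ g ω) = ρ g (τ ω)) (F : Ω → E) : F (ρ g (τ ω)) - F (τ (ρ g ω)) = 0 := by
  rw [h, sub_self]

/-- ADDITIVE PROPAGATION through nesting: if the outer operation is additive, the defect of the composite is the
outer image of the inner defect plus the outer defect at the inner output. [folklore] -/
theorem CovariantUpTo.comp [AddCommMonoid E] {ρ : G → Ω → Ω} {𝕋₁ 𝕋₂ : Op Ω E}
    {D₁ D₂ : G → (Ω → E) → (Ω → E)} (h₁ : CovariantUpTo ρ 𝕋₁ D₁) (h₂ : CovariantUpTo ρ 𝕋₂ D₂)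
    (hadd : ∀ H K : Ω → E, 𝕋₁ (H + K) = 𝕋₁ H + 𝕋₁ K) :
    CovariantUpTo ρ (𝕋₁ ∘ 𝕋₂) fun g F => D₁ g (𝕋₂ F) + 𝕋₁ (D₂ g F) := by
  intro g F
  show 𝕋₁ (𝕋₂ _) = _
  rw [h₂ g F, hadd, h₁ g (𝕋₂ F), add_assoc]
  rfl

/-- Defects of a finite sum of operations add. [folklore] -/
theorem CovariantUpTo.sumOp [AddCommMonoid E] {ρ : G → Ω → Ω} {ι : Type*} {s : Finset ι} {𝕋 : ι → Op Ω E}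
    {D : ι → G → (Ω → E) → (Ω → E)} (h : ∀ i ∈ s, CovariantUpTo ρ (𝕋 i) (D i)) :
    CovariantUpTo ρ (sumOp s 𝕋) fun g F => ∑ i ∈ s, D i g F := fun g F => by
  funext ω
  simp only [T4NestedCovariance.sumOp, Pi.add_apply, Finset.sum_apply, ← Finset.sum_add_distrib]
  exact Finset.sum_congr rfl fun i hi => by rw [h i hi g F]; rfl

/-- A multiplication node by a NON-invariant weight has the defect `(χ − χ ∘ ρ g) · (F ∘ ρ g)`. [folklore] -/
theorem covariantUpTo_mulOp [Ring 𝕜] [AddCommGroup E] [Module 𝕜 E] (ρ : G → Ω → Ω) (χ : Ω → 𝕜) :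
    CovariantUpTo ρ (mulOp χ : Op Ω E) fun g F ω => (χ ω - χ (ρ g ω)) • F (ρ g ω) := fun g F => by
  funext ω
  simp only [mulOp, Pi.add_apply, sub_smul, add_sub_cancel]

end Defect

/-! ## §6  The consumer: flat exterior ⇒ fixed vector ⇒ zero conditional mean -/

section Consumer

variable {G : Type*} {Ω : Type u} {E : Type w}

/-- A configuration `ω₀` is FIXED by the family MODULO the projection `π` (to the variables an operation does not
integrate): `π (ρ g ω₀) = π ω₀` — the exterior configuration is rotation invariant (FLAT, e.g. ≡ 1). [folklore] -/
def FixedModulo {Y : Type*} (ρ : G → Ω → Ω) (π : Ω → Y) (ω₀ : Ω) : Prop := ∀ g, π (ρ g ω₀) = π ω₀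

/-- If the output of an operation is a function of the exterior variables only and the exterior of `ω₀` is fixed,
the output takes the same value along the orbit of `ω₀`. [folklore] -/
theorem apply_eq_of_factorsThrough {Y : Type*} {ρ : G → Ω → Ω} {π : Ω → Y} {ω₀ : Ω} {H : Ω → E}
    (hH : H.FactorsThrough π) (hω₀ : FixedModulo ρ π ω₀) (g : G) : H (ρ g ω₀) = H ω₀ := hH (hω₀ g)

/-- FIXED VECTOR: an equivariant function constant along the orbit of `ω₀` takes a `σ`-fixed value there. [folklore] -/
theorem fixed_of_equivariant {ρ : G → Ω → Ω} {σ : G → E → E} {H : Ω → E} (hH : Equivariant ρ σ H) {ω₀ : Ω}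
    (hfix : ∀ g, H (ρ g ω₀) = H ω₀) (g : G) : σ g (H ω₀) = H ω₀ := by rw [← hH g ω₀, hfix g]

variable [NormedAddCommGroup E]

/-- ZERO AT A FLAT EXTERIOR, for any covariant operation commuting with a fixed-vector-free representation: the
output of an equivariant integrand vanishes at a configuration fixed modulo the exterior.  (Covers operations that
are not forms, e.g. a one-level law supplied by another module.) [folklore] -/
theorem apply_eq_zero_of_covariant [NormedSpace ℝ E] {ρ : G → Ω → Ω} (σ : G → E ≃L[ℝ] E)
    (hσ : T4AdInvariant.NoFixedVector fun g => ((σ g : E →L[ℝ] E) : E →ₗ[ℝ] E)) {𝕋 : Op Ω E}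
    (hcov : Covariant ρ 𝕋) (hcomm : ∀ g, CommutesWith (σ g) 𝕋) {F : Ω → E}
    (hF : Equivariant ρ (fun g => σ g) F) {ω₀ : Ω} (hfix : ∀ g, 𝕋 F (ρ g ω₀) = 𝕋 F ω₀) : 𝕋 F ω₀ = 0 :=
  hσ _ fun g => fixed_of_equivariant (hF.op hcov hcomm) hfix g

/-- `T4FirstOrderSize.MeanVanishes` FROM COVARIANCE: if for every bond `b ∈ S` the fluctuation insert `B b` is an
equivariant integrand, the (conditional-mean) operation `𝕋` is covariant and commutes with the representation, the
representation has no fixed vector, and the exterior of `ω₀` is flat, then the mean field `b ↦ 𝕋 (B b) ω₀`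
vanishes on `S`. [folklore] -/
theorem meanVanishes_of_covariant [InnerProductSpace ℝ E] {β : Type*} {ρ : G → Ω → Ω} (σ : G → E ≃L[ℝ] E)
    (hσ : T4AdInvariant.NoFixedVector fun g => ((σ g : E →L[ℝ] E) : E →ₗ[ℝ] E)) {𝕋 : Op Ω E}
    (hcov : Covariant ρ 𝕋) (hcomm : ∀ g, CommutesWith (σ g) 𝕋) {S : Finset β} {B : β → Ω → E}
    (hB : ∀ b ∈ S, Equivariant ρ (fun g => σ g) (B b)) {ω₀ : Ω}
    (hfix : ∀ b ∈ S, ∀ g, 𝕋 (B b) (ρ g ω₀) = 𝕋 (B b) ω₀) :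
    T4FirstOrderSize.MeanVanishes S fun b => 𝕋 (B b) ω₀ := fun b hb =>
  apply_eq_zero_of_covariant σ hσ hcov hcomm (hB b hb) (hfix b hb)

/-- THE ROW'S CONCLUSION SHAPE through nested forms: `MeanVanishes` for the mean field computed by ANY adapted form
(old operations nested to any depth) at a flat exterior, given a fixed-vector-free representation. [folklore] -/
theorem Form.meanVanishes [InnerProductSpace ℝ E] {β : Type*} {ρ : G → Ω → Ω} (σ : G → E ≃L[ℝ] E)
    (hσ : T4AdInvariant.NoFixedVector fun g => ((σ g : E →L[ℝ] E) : E →ₗ[ℝ] E)) (f : Form Ω ℝ)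
    (hf : f.Adapted ρ) {S : Finset β} {B : β → Ω → E} (hB : ∀ b ∈ S, Equivariant ρ (fun g => σ g) (B b))
    {ω₀ : Ω} (hfix : ∀ b ∈ S, ∀ g, f.eval (B b) (ρ g ω₀) = f.eval (B b) ω₀) :
    T4FirstOrderSize.MeanVanishes S fun b => f.eval (B b) ω₀ :=
  meanVanishes_of_covariant σ hσ (Form.covariant_eval f hf) (fun g => Form.commutesWith_eval (σ g) f) hB hfix

/-! ### The 𝔰𝔲(2) coordinate instance (`T4AdInvariant`'s carrier `Fin 2 → Fin 2 → ℂ`, conjugation) -/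

open T4AdInvariant in
/-- `Matrix.of` of a conjugated value. [folklore] -/
theorem of_conjOp (U : Matrix (Fin 2) (Fin 2) ℂ) (v : Fin 2 → Fin 2 → ℂ) :
    Matrix.of (conjOp U v) = U * Matrix.of v * star U := by
  ext i j
  rfl

open T4AdInvariant in
/-- Conjugation by `U⋆` undoes conjugation by a unitary `U`. [folklore] -/
theorem conjOp_star_conjOp (U : Matrix.specialUnitaryGroup (Fin 2) ℂ) (v : Fin 2 → Fin 2 → ℂ) :
    conjOp (star (U : Matrix (Fin 2) (Fin 2) ℂ)) (conjOp (U : Matrix (Fin 2) (Fin 2) ℂ) v) = v := by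
  have hU : star (U : Matrix (Fin 2) (Fin 2) ℂ) * U = 1 :=
    Matrix.mem_unitaryGroup_iff'.mp (Matrix.mem_specialUnitaryGroup_iff.mp U.2).1
  apply Matrix.of.injective
  rw [of_conjOp, of_conjOp, star_star, ← Matrix.mul_assoc, ← Matrix.mul_assoc, hU, Matrix.one_mul,
    Matrix.mul_assoc, hU, Matrix.mul_one]

open T4AdInvariant in
/-- Conjugation by a unitary `U` undoes conjugation by `U⋆`. [folklore] -/
theorem conjOp_conjOp_star (U : Matrix.specialUnitaryGroup (Fin 2) ℂ) (v : Fin 2 → Fin 2 → ℂ) :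
    conjOp (U : Matrix (Fin 2) (Fin 2) ℂ) (conjOp (star (U : Matrix (Fin 2) (Fin 2) ℂ)) v) = v := by
  have hU : (U : Matrix (Fin 2) (Fin 2) ℂ) * star (U : Matrix (Fin 2) (Fin 2) ℂ) = 1 :=
    Matrix.mem_unitaryGroup_iff.mp (Matrix.mem_specialUnitaryGroup_iff.mp U.2).1
  apply Matrix.of.injective
  rw [of_conjOp, of_conjOp, star_star, ← Matrix.mul_assoc, ← Matrix.mul_assoc, hU, Matrix.one_mul,
    Matrix.mul_assoc, hU, Matrix.mul_one]

open T4AdInvariant in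
/-- Conjugation by `U ∈ SU(2)` as a continuous ℝ-linear AUTOMORPHISM of `Fin 2 → Fin 2 → ℂ` (inverse: conjugation
by `U⋆`), so that `Form.commutesWith_eval` applies to it. [folklore] -/
def conjEquiv (U : Matrix.specialUnitaryGroup (Fin 2) ℂ) : (Fin 2 → Fin 2 → ℂ) ≃L[ℝ] (Fin 2 → Fin 2 → ℂ) :=
  LinearEquiv.toContinuousLinearEquiv
    { (conjOp (U : Matrix (Fin 2) (Fin 2) ℂ) : (Fin 2 → Fin 2 → ℂ) →ₗ[ℝ] (Fin 2 → Fin 2 → ℂ)) with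
      invFun := conjOp (star (U : Matrix (Fin 2) (Fin 2) ℂ))
      left_inv := conjOp_star_conjOp U
      right_inv := conjOp_conjOp_star U }

open T4AdInvariant in
/-- `conjEquiv U` acts as `conjOp U`. [folklore] -/
@[simp] theorem conjEquiv_apply (U : Matrix.specialUnitaryGroup (Fin 2) ℂ) (v : Fin 2 → Fin 2 → ℂ) :
    conjEquiv U v = conjOp (U : Matrix (Fin 2) (Fin 2) ℂ) v := rfl

/-- TRACELESSNESS IS PRESERVED by every form with real weights (unconditionally): pointwise traceless integrands
have pointwise traceless outputs (`T4AdInvariant.trace_integral_eq_zero` at fibre nodes — no integrability).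
[folklore] -/
theorem Form.traceless_eval : ∀ (f : Form Ω ℝ) {F : Ω → Fin 2 → Fin 2 → ℂ},
    (∀ ω, F ω 0 0 + F ω 1 1 = 0) → ∀ ω, f.eval F ω 0 0 + f.eval F ω 1 1 = 0
  | .one, _, hF, ω => hF ω
  | .mul χ, _, hF, ω => by simp only [Form.eval_mul, Pi.smul_apply, ← smul_add, hF ω, smul_zero]
  | .subst τ, _, hF, ω => hF (τ ω)
  | .fibre S mS ν ins, F, hF, ω =>
      @T4AdInvariant.trace_integral_eq_zero S mS ν (fun s => F (ins s ω)) fun s => hF (ins s ω)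
  | .comp f₁ f₂, _, hF, ω => Form.traceless_eval f₁ (Form.traceless_eval f₂ hF) ω
  | .sum _ s f, _, hF, ω => by
      simp only [Form.eval_sum, Finset.sum_apply, ← Finset.sum_add_distrib]
      exact Finset.sum_eq_zero fun i _ => Form.traceless_eval (f i) hF ω

/-- THE 𝔰𝔲(2) INSTANCE OF THE ROW'S CONCLUSION: through any form adapted to the joint conjugation, a
conjugation-equivariant (`T4AdInvariant.ConjEquivariant`), pointwise traceless 2 × 2-matrix-valued integrand has
output ZERO at every configuration whose orbit the output does not see (flat exterior) — (k1) of `T4AdInvariant`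
supplies the absence of fixed vectors.  No integrability or measurability hypothesis. [folklore] -/
theorem Form.eval_eq_zero_of_conjEquivariant {ρ : Matrix.specialUnitaryGroup (Fin 2) ℂ → Ω → Ω}
    (f : Form Ω ℝ) (hf : f.Adapted ρ) {F : Ω → Fin 2 → Fin 2 → ℂ} (hF : T4AdInvariant.ConjEquivariant ρ F)
    (htr : ∀ ω, F ω 0 0 + F ω 1 1 = 0) {ω₀ : Ω} (hfix : ∀ g, f.eval F (ρ g ω₀) = f.eval F ω₀) :
    f.eval F ω₀ = 0 := by
  have hF' : Equivariant ρ (fun g => conjEquiv g) F := fun g ω => by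
    simpa only [conjEquiv_apply] using hF g ω
  have heq := Form.equivariant_eval (fun g => conjEquiv g) f hf hF'
  refine T4AdInvariant.pi_traceless_eq_zero_of_conj_invariant _ (Form.traceless_eval f htr ω₀) fun U hU => ?_
  have h := fixed_of_equivariant heq hfix ⟨U, hU⟩
  simpa only [conjEquiv_apply, Subtype.coe_mk] using h

/-- The same with the flat exterior given STRUCTURALLY: the output factors through a projection `π` under which
`ω₀` is fixed. [folklore] -/
theorem Form.eval_eq_zero_of_conjEquivariant_of_factorsThrough {Y : Type*}
    {ρ : Matrix.specialUnitaryGroup (Fin 2) ℂ → Ω → Ω} (f : Form Ω ℝ) (hf : f.Adapted ρ)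
    {F : Ω → Fin 2 → Fin 2 → ℂ} (hF : T4AdInvariant.ConjEquivariant ρ F) (htr : ∀ ω, F ω 0 0 + F ω 1 1 = 0)
    {π : Ω → Y} (hπ : (f.eval F).FactorsThrough π) {ω₀ : Ω} (hω₀ : FixedModulo ρ π ω₀) : f.eval F ω₀ = 0 :=
  Form.eval_eq_zero_of_conjEquivariant f hf hF htr (apply_eq_of_factorsThrough hπ hω₀)

end Consumer

end Literature.MathematicalPhysics.QuantumFieldTheory.Balaban1983to89.T4NestedCovariance
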